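import Summits.Ventures.PercRepro.PlaneCore
import Summits.Ventures.PercRepro.RankLevelSetHClose

/-!
# PercRepro — Theorem O, piece (O4): the max-trace weighting on the planes of a simple matroid (p2, gen 5)

`proofs/MINE2-RLS.md` §16 Step 1, for a finite SIMPLE matroid `M` (`ThmH.Simple`), `(p, q) = (5, 3)`:
`Y := {S ⊆ E : ρ(S) = 4}`, `U′ := {B ⊆ E : ρ(B) = 3, ρ(E ∖ B) ≥ 5}`, `U′_G := {B ⊆ G : ρ(B) = 3, ρ(E ∖ B) ≥ 5}` for a
plane `G` (rank-3 flat), `N₃(G) := {B ⊆ G : ρ(B) = 3}`.  A set `S ∈ Y` is given UNIFORMLY to the planes with the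
largest trace `|S ∩ P|` (`w M G S = 1/#Max(S)` if `G ∈ Max(S)`, else `0`), so `Σ_G w(G, S) ≤ 1` and
`Σ_G supply(G) ≤ #Y` (`sum_supply_le`); `U′` injects into `⊔_G U′_G` (`card_U_le`).  The witnesses of a plane `G`
are the sets `S = B′ ∪ {x}` with `B′ ∈ N₃(G)` and `x ∈ E ∖ G` (rank `4`, pairwise distinct); the maximizers of such
an `S` are `G` and the planes `cl(ℓ ∪ {x})` for the lines `ℓ` of `G` with `|ℓ ∩ B′| = |B′| − 1` (`maximizers_eq`):
hence `w(G, S) ≥ wt(B′)` with `wt = 1/4` for `|B′| = 3`, `1/2` for `|B′| ≥ 4` with such a line, `1` otherwise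
(`w_witness_ge`), and `supply(G) ≥ |E ∖ G| · Σ_{B′ ∈ N₃(G)} wt(B′)` (`supply_ge`).
Imports Mathlib, `RankLevelSetHCore`, `PlaneCore`.
-/

namespace PercRepro

namespace ThmO

open Finset ThmH

variable {α : Type*} [DecidableEq α] {M : Matroid α} [M.Finite]

open scoped Classical in
/-- `Y = {S ⊆ E : ρ(S) = 4}`. -/
noncomputable def Y (M : Matroid α) [M.Finite] : Finset (Finset α) :=
  (gr M).powerset.filter (fun S => M.eRk (S : Set α) = 4)

open scoped Classical in
/-- `U′ = {B ⊆ E : ρ(B) = 3, ρ(E ∖ B) ≥ 5}`. -/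
noncomputable def U (M : Matroid α) [M.Finite] : Finset (Finset α) :=
  (gr M).powerset.filter (fun B => M.eRk (B : Set α) = 3 ∧ (5 : ℕ∞) ≤ M.eRk ((gr M \ B : Finset α) : Set α))

open scoped Classical in
/-- `U′_G = {B ⊆ G : ρ(B) = 3, ρ(E ∖ B) ≥ 5}`. -/
noncomputable def UG (M : Matroid α) [M.Finite] (G : Finset α) : Finset (Finset α) :=
  G.powerset.filter (fun B => M.eRk (B : Set α) = 3 ∧ (5 : ℕ∞) ≤ M.eRk ((gr M \ B : Finset α) : Set α))

open scoped Classical in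
/-- `N₃(G) = {B ⊆ G : ρ(B) = 3}`. -/
noncomputable def N3 (M : Matroid α) [M.Finite] (G : Finset α) : Finset (Finset α) :=
  G.powerset.filter (fun B => M.eRk (B : Set α) = 3)

/-- The largest trace of `S` on a plane. -/
noncomputable def maxTrace (M : Matroid α) [M.Finite] (S : Finset α) : ℕ :=
  (planes M).sup (fun P => (S ∩ P).card)

open scoped Classical in
/-- The maximizers: the planes whose trace on `S` is largest. -/
noncomputable def Max (M : Matroid α) [M.Finite] (S : Finset α) : Finset (Finset α) :=
  (planes M).filter (fun P => (S ∩ P).card = maxTrace M S)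

open scoped Classical in
/-- The weight `S` pays the plane `G`: `1 / #Max(S)` if `G` is a maximizer, else `0`. -/
noncomputable def w (M : Matroid α) [M.Finite] (G S : Finset α) : ℚ :=
  if G ∈ Max M S then 1 / ((Max M S).card : ℚ) else 0

/-- The weights are nonnegative. -/
theorem w_nonneg (M : Matroid α) [M.Finite] (G S : Finset α) : 0 ≤ w M G S := by
  unfold w; split_ifs <;> positivity

/-- `Σ_G w(G, S) ≤ 1`. -/
theorem sum_w_le_one (M : Matroid α) [M.Finite] (S : Finset α) : ∑ G ∈ planes M, w M G S ≤ 1 := by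
  classical
  unfold w
  have hsub : Max M S ⊆ planes M := Finset.filter_subset _ _
  rw [Finset.sum_ite_mem, Finset.inter_eq_right.2 hsub, Finset.sum_const, nsmul_eq_mul]
  rcases Nat.eq_zero_or_pos (Max M S).card with h0 | hpos
  · rw [h0]; simp
  · rw [mul_one_div, div_self (by exact_mod_cast hpos.ne')]

/-- The supply of a plane: the total weight it receives from `Y`. -/
noncomputable def supply (M : Matroid α) [M.Finite] (G : Finset α) : ℚ := ∑ S ∈ Y M, w M G S

/-- `Σ_G supply(G) ≤ #Y`. -/
theorem sum_supply_le (M : Matroid α) [M.Finite] : ∑ G ∈ planes M, supply M G ≤ ((Y M).card : ℚ) := by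
  unfold supply
  rw [Finset.sum_comm]
  calc ∑ S ∈ Y M, ∑ G ∈ planes M, w M G S ≤ ∑ S ∈ Y M, (1 : ℚ) :=
        Finset.sum_le_sum (fun S _ => sum_w_le_one M S)
    _ = (Y M).card := by simp

/-- `#U′ ≤ Σ_G #U′_G` (`B ↦ (cl B, B)`). -/
theorem card_U_le (M : Matroid α) [M.Finite] : (U M).card ≤ ∑ G ∈ planes M, (UG M G).card := by
  classical
  rw [← Finset.card_sigma]
  refine Finset.card_le_card_of_injOn (fun B => (⟨clF M B, B⟩ : Σ _ : Finset α, Finset α)) ?_ ?_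
  · intro B hB
    simp only [Finset.mem_coe, U, Finset.mem_filter, Finset.mem_powerset] at hB
    obtain ⟨hBE, hB3, hB5⟩ := hB
    obtain ⟨hplane, hBcl⟩ := clF_mem_planes hBE hB3
    simp only [Finset.mem_coe, Finset.mem_sigma, UG, Finset.mem_filter, Finset.mem_powerset]
    exact ⟨hplane, hBcl, hB3, hB5⟩
  · intro B _ B' _ h
    have := congrArg Sigma.snd h
    simpa using this

/-! ### The maximizers of a witness `S = B′ ∪ {x}` -/

section Witness

variable {G B : Finset α} {x : α}

/-- The trace of the witness on its plane is `B′`. -/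
theorem witness_inter_self (hB : B ⊆ G) (hxG : x ∉ G) : insert x B ∩ G = B := by
  ext y
  simp only [Finset.mem_inter, Finset.mem_insert]
  constructor
  · rintro ⟨rfl | hy, hyG⟩
    · exact absurd hyG hxG
    · exact hy
  · intro hy; exact ⟨Or.inr hy, hB hy⟩

/-- A rank-3 subset of the plane `G` is not contained in any other plane. -/
theorem not_subset_of_ne (hG : G ∈ planes M) (hB : B ⊆ G) (hr : M.eRk (B : Set α) = 3)
    {P : Finset α} (hP : P ∈ planes M) (hne : P ≠ G) : ¬ B ⊆ P := by
  intro hBP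
  have h := eRk_inter_le_two_of_ne hP hG hne
  have h2 : M.eRk (B : Set α) ≤ M.eRk ((P ∩ G : Finset α) : Set α) :=
    M.eRk_mono (Finset.coe_subset.2 (Finset.subset_inter hBP hB))
  rw [hr] at h2
  have := h2.trans h
  norm_num at this

/-- On any other plane `P` the witness has trace at most `|B′|`, and it lies in `(B′ ∩ P) ∪ {x}`. -/
theorem trace_le_of_ne (hG : G ∈ planes M) (hB : B ⊆ G) (hr : M.eRk (B : Set α) = 3)
    (hxG : x ∉ G) {P : Finset α} (hP : P ∈ planes M) (hne : P ≠ G) :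
    (insert x B ∩ P).card ≤ B.card ∧ (insert x B ∩ P) ⊆ insert x (B ∩ P) ∧ (B ∩ P).card + 1 ≤ B.card := by
  have hsub : insert x B ∩ P ⊆ insert x (B ∩ P) := by
    intro y hy
    rw [Finset.mem_inter, Finset.mem_insert] at hy
    rw [Finset.mem_insert, Finset.mem_inter]
    rcases hy with ⟨rfl | hyB, hyP⟩
    · exact Or.inl rfl
    · exact Or.inr ⟨hyB, hyP⟩
  have hlt : (B ∩ P).card < B.card := by
    apply Finset.card_lt_card
    rw [Finset.ssubset_iff_subset_ne]
    refine ⟨Finset.inter_subset_left, ?_⟩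
    intro heq
    have : B ⊆ P := by rw [← heq]; exact Finset.inter_subset_right
    exact not_subset_of_ne hG hB hr hP hne this
  refine ⟨?_, hsub, hlt⟩
  calc (insert x B ∩ P).card ≤ (insert x (B ∩ P)).card := Finset.card_le_card hsub
    _ ≤ (B ∩ P).card + 1 := Finset.card_insert_le _ _
    _ ≤ B.card := hlt

/-- The largest trace of a witness is `|B′|`, attained on `G`. -/
theorem maxTrace_witness (hG : G ∈ planes M) (hB : B ⊆ G) (hr : M.eRk (B : Set α) = 3)
    (hxG : x ∉ G) : maxTrace M (insert x B) = B.card := by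
  classical
  unfold maxTrace
  apply le_antisymm
  · apply Finset.sup_le
    intro P hP
    by_cases hne : P = G
    · subst hne; rw [witness_inter_self hB hxG]
    · exact (trace_le_of_ne hG hB hr hxG hP hne).1
  · have := Finset.le_sup (f := fun P => (insert x B ∩ P).card) hG
    simpa [witness_inter_self hB hxG] using this

/-- `G` is a maximizer of its witness. -/
theorem mem_Max_witness (hG : G ∈ planes M) (hB : B ⊆ G) (hr : M.eRk (B : Set α) = 3)
    (hxG : x ∉ G) : G ∈ Max M (insert x B) := by
  classical
  simp only [Max, Finset.mem_filter]
  exact ⟨hG, by rw [witness_inter_self hB hxG, maxTrace_witness hG hB hr hxG]⟩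

open scoped Classical in
/-- The lines of `G` meeting `B′` in all but one point. -/
noncomputable def tieLines (M : Matroid α) [M.Finite] (G B : Finset α) : Finset (Finset α) :=
  (lines M).filter (fun ℓ => ℓ ⊆ G ∧ (ℓ ∩ B).card + 1 = B.card)

/-- A maximizer other than `G` contains `x`, meets `B′` in `|B′| − 1` points, and determines a tie line
`cl(P ∩ G)`; the map `P ↦ cl(P ∩ G)` is injective on `Max(S) ∖ {G}` into `tieLines`. -/
theorem card_Max_le (hs : Simple M) (hG : G ∈ planes M) (hB : B ⊆ G) (hr : M.eRk (B : Set α) = 3)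
    (hx : x ∈ gr M) (hxG : x ∉ G) :
    (Max M (insert x B)).card ≤ 1 + (tieLines M G B).card := by
  classical
  have hGmem := mem_Max_witness hG hB hr hxG
  have hGE := (mem_planes.1 hG).1
  have hBE : B ⊆ gr M := hB.trans hGE
  rw [← Finset.card_erase_add_one hGmem, add_comm]
  apply Nat.add_le_add_left
  refine Finset.card_le_card_of_injOn (fun P => clF M (P ∩ G)) ?_ ?_
  · -- maps into tieLines
    intro P hP
    rw [Finset.mem_coe, Finset.mem_erase] at hP
    obtain ⟨hne, hPmax⟩ := hP
    simp only [Max, Finset.mem_filter] at hPmax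
    obtain ⟨hP, htr⟩ := hPmax
    rw [maxTrace_witness hG hB hr hxG] at htr
    obtain ⟨-, hsub, hlt⟩ := trace_le_of_ne hG hB hr hxG hP hne
    -- |B ∩ P| = |B| − 1 and x ∈ P
    have hcard : (B ∩ P).card + 1 = B.card := by
      have h1 := Finset.card_le_card hsub
      have h2 := Finset.card_insert_le x (B ∩ P)
      omega
    have hBP2 : 2 ≤ (B ∩ P).card := by
      have := M.eRk_le_encard (B : Set α)
      rw [hr, Set.encard_coe_eq_coe_finsetCard] at this
      have h3 : 3 ≤ B.card := by exact_mod_cast this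
      omega
    -- the line cl(P ∩ G)
    have hPG2 : M.eRk ((P ∩ G : Finset α) : Set α) = 2 := by
      apply le_antisymm (eRk_inter_le_two_of_ne hP hG hne)
      obtain ⟨a, ha, b, hb, hab⟩ := Finset.one_lt_card.1 (show 1 < (B ∩ P).card by omega)
      have hsubPG : B ∩ P ⊆ P ∩ G := by
        intro y hy; rw [Finset.mem_inter] at hy ⊢; exact ⟨hy.2, hB hy.1⟩
      exact two_le_eRk_of_two_mem hs (Finset.inter_subset_right.trans hGE) (hsubPG ha) (hsubPG hb) hab
    have hPGE : P ∩ G ⊆ gr M := Finset.inter_subset_right.trans hGE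
    obtain ⟨hline, hPGcl⟩ := clF_mem_lines hPGE hPG2
    rw [Finset.mem_coe, tieLines, Finset.mem_filter]
    refine ⟨hline, ?_, ?_⟩
    · -- cl(P ∩ G) ⊆ G
      rw [← Finset.coe_subset, coe_clF]
      have := M.closure_subset_closure (Finset.coe_subset.2 (Finset.inter_subset_right : P ∩ G ⊆ G))
      rwa [(mem_planes.1 hG).2.1.closure] at this
    · -- |cl(P ∩ G) ∩ B| = |B| − 1
      have hge : B ∩ P ⊆ clF M (P ∩ G) ∩ B := by
        intro y hy
        rw [Finset.mem_inter] at hy ⊢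
        exact ⟨hPGcl (Finset.mem_inter.2 ⟨hy.2, hB hy.1⟩), hy.1⟩
      have h1 := Finset.card_le_card hge
      show (clF M (P ∩ G) ∩ B).card + 1 = B.card
      have h2 : (clF M (P ∩ G) ∩ B).card < B.card := by
        apply Finset.card_lt_card
        rw [Finset.ssubset_iff_subset_ne]
        refine ⟨Finset.inter_subset_right, ?_⟩
        intro heq
        have hBsub : B ⊆ clF M (P ∩ G) := by rw [← heq]; exact Finset.inter_subset_left
        have := M.eRk_mono (Finset.coe_subset.2 hBsub)
        rw [hr, coe_clF, M.eRk_closure_eq, hPG2] at this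
        norm_num at this
      omega
  · -- injective: two maximizers with the same tie line both contain ℓ ∪ {x}
    intro P hP P' hP' heq
    rw [Finset.mem_coe, Finset.mem_erase] at hP hP'
    obtain ⟨hne, hPmax⟩ := hP
    obtain ⟨hne', hPmax'⟩ := hP'
    simp only [Max, Finset.mem_filter] at hPmax hPmax'
    obtain ⟨hPpl, htr⟩ := hPmax
    obtain ⟨hPpl', htr'⟩ := hPmax'
    simp only at heq
    -- x ∈ P and x ∈ P′
    have hxP : ∀ Q ∈ planes M, Q ≠ G → (insert x B ∩ Q).card = maxTrace M (insert x B) → x ∈ Q := by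
      intro Q hQ hQne hQtr
      rw [maxTrace_witness hG hB hr hxG] at hQtr
      by_contra hxQ
      have : insert x B ∩ Q = B ∩ Q := by
        ext y
        simp only [Finset.mem_inter, Finset.mem_insert]
        constructor
        · rintro ⟨rfl | hy, hyQ⟩
          · exact absurd hyQ hxQ
          · exact ⟨hy, hyQ⟩
        · rintro ⟨hy, hyQ⟩; exact ⟨Or.inr hy, hyQ⟩
      rw [this] at hQtr
      have := (trace_le_of_ne hG hB hr hxG hQ hQne).2.2
      omega
    have hxP1 := hxP P hPpl hne htr
    have hxP2 := hxP P' hPpl' hne' htr'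
    -- the common line ℓ = cl(P ∩ G) = cl(P′ ∩ G), of rank 2, and ℓ ∪ {x} has rank 3
    have hPG2 : M.eRk ((P ∩ G : Finset α) : Set α) = 2 := by
      apply le_antisymm (eRk_inter_le_two_of_ne hPpl hG hne)
      rw [maxTrace_witness hG hB hr hxG] at htr
      obtain ⟨-, hsub, hlt⟩ := trace_le_of_ne hG hB hr hxG hPpl hne
      have hcard : (B ∩ P).card + 1 = B.card := by
        have h1 := Finset.card_le_card hsub
        have h2 := Finset.card_insert_le x (B ∩ P)
        omega
      have h3 : 3 ≤ B.card := by
        have := M.eRk_le_encard (B : Set α)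
        rw [hr, Set.encard_coe_eq_coe_finsetCard] at this
        exact_mod_cast this
      obtain ⟨a, ha, b, hb, hab⟩ := Finset.one_lt_card.1 (show 1 < (B ∩ P).card by omega)
      have hsubPG : B ∩ P ⊆ P ∩ G := by
        intro y hy; rw [Finset.mem_inter] at hy ⊢; exact ⟨hy.2, hB hy.1⟩
      exact two_le_eRk_of_two_mem hs (Finset.inter_subset_right.trans hGE) (hsubPG ha) (hsubPG hb) hab
    have hℓline : clF M (P ∩ G) ∈ lines M := (clF_mem_lines (Finset.inter_subset_right.trans hGE) hPG2).1
    have hℓG : clF M (P ∩ G) ⊆ G := by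
      rw [← Finset.coe_subset, coe_clF]
      have := M.closure_subset_closure (Finset.coe_subset.2 (Finset.inter_subset_right : P ∩ G ⊆ G))
      rwa [(mem_planes.1 hG).2.1.closure] at this
    have hℓP : clF M (P ∩ G) ⊆ P := by
      rw [← Finset.coe_subset, coe_clF]
      have := M.closure_subset_closure (Finset.coe_subset.2 (Finset.inter_subset_left : P ∩ G ⊆ P))
      rwa [(mem_planes.1 hPpl).2.1.closure] at this
    have hℓP' : clF M (P ∩ G) ⊆ P' := by
      have e : clF M (P ∩ G) = clF M (P' ∩ G) := heq
      rw [e, ← Finset.coe_subset, coe_clF]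
      have := M.closure_subset_closure (Finset.coe_subset.2 (Finset.inter_subset_left : P' ∩ G ⊆ P'))
      rwa [(mem_planes.1 hPpl').2.1.closure] at this
    have hℓc : 2 ≤ (clF M (P ∩ G)).card := two_le_card_of_mem_lines hℓline
    have hxℓ : x ∉ clF M (P ∩ G) := fun h => hxG (hℓG h)
    have h3 : M.eRk ((insert x (clF M (P ∩ G)) : Finset α) : Set α) = 3 :=
      eRk_insert_eq_three hs hℓline (subset_refl _) hℓc hx hxℓ
    exact planes_eq_of_subset hPpl hPpl' (Finset.insert_subset hxP1 hℓP) (Finset.insert_subset hxP2 hℓP') h3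

end Witness

end ThmO

end PercRepro
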